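import Literature.MathematicalPhysics.KineticTheory.KickMatchedHardSphereGas
import HarnessLib

/-!
# The one-kick influence of the kick-matched gas lies in `[0, 1]`

Helper file of the stub `stub_oneKickInfluence` (S2) of the crux line `stein-lindeberg-kick-swap`
(crux `InformationPercolationEngine.PercolationClosesChaos`, stmt-AtomisticToContinuum-13914), also needed by S3b
(`SwapSumDomination`): elementary API of the swap vocabulary of
`Literature.MathematicalPhysics.KineticTheory.KickMatchedHardSphereGas` (namespace opened and extended here).

* `swapValue_nonneg`, `swapValue_le_one` — the `Z*`-value `swapValue … ω = ∫ φ_η ∘ defect ∘ contPath dkmDice` lies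
  in `[0, 1]` for `0 ≤ η` (the integrand does; the junk value `0` of a non-integrable integrand obeys the bounds);
  `abs_swapValue_sub_le_one` — two `Z*`-values differ by at most `1`.
* `influence_nonneg` (unconditional), `influence_le_one` (`0 ≤ η`) — the one-kick influence, a real `iSup` over the
  subtype of pairs of admissible kicks, is a genuine supremum in `[0, 1]` (`Real.iSup_nonneg`, `Real.iSup_le`; an empty
  admissible family gives `0`); `bddAbove_range_swapValue_sub`; `abs_sub_le_influence` — the oscillation dominates
  every admissible difference (`le_ciSup`).
* `ite_influence_le`, `sum_ite_influence_le_numColl`, `sum_ite_influence_antitone` — the Lindeberg-truncated influence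
  sum `Σ_{k < numColl} influence_k · 1{influence_k > a}` of S2 is dominated by the number of collisions and is antitone
  in the threshold `a`.
* `abs_swapValue_sub_restrictedMean_le_influence`, `abs_swapIntegrand_le_influence` — the form in which S3b consumes S2:
  whenever the restricted reference mean at the `k`-th collision is a genuine average (admissible set of positive finite
  flux measure, `ω ↦ swapValue_k ω` integrable on it), `|swapIntegrand_k ω| ≤ influence_k` for every kick `ω`
  (`norm_setIntegral_le_of_norm_le_const`; no measurability of the admissible set is needed).

Reference: S. Chatterjee, *A generalization of the Lindeberg principle*, Ann. Probab. 34 (2006) 2061–2076,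
doi:10.1214/009117906000000575, §1 (one-coordinate swap influences bounded by the oscillation of the test
statistic). Tagged `[folklore]` (elementary order facts about the tree's definitions).
-/

noncomputable section

open scoped BigOperators ENNReal Topology RealInnerProductSpace
open MeasureTheory Set Filter
open Literature.Analysis.FluidPDE

namespace Literature.MathematicalPhysics.KineticTheory

namespace KickMatchedHardSphereGas

variable {σ : ℝ} {N : ℕ} (Φ : Flow σ N) (τ : ℝ) (χ : ℝ × T3 → ℝ) (Ψ : V3 × V3 × V3 → ℝ) (r : ℝ) {η : ℝ}

/-! ## `swapValue ∈ [0, 1]` -/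

/-- `0 ≤ swapValue` for `0 ≤ η`: the dice-integrand `φ_η ∘ defect` is nonnegative (the junk value `0` of a
non-integrable integrand also obeys the bound). [folklore] -/
theorem swapValue_nonneg (hη : 0 ≤ η) (z : Cfg N) (k : ℕ) (ω : V3) : 0 ≤ swapValue σ N Φ τ χ Ψ r η z k ω :=
  integral_nonneg fun _ => phiEta_nonneg hη _

/-- `swapValue ≤ 1` for `0 ≤ η`. [folklore] -/
theorem swapValue_le_one (hη : 0 ≤ η) (z : Cfg N) (k : ℕ) (ω : V3) : swapValue σ N Φ τ χ Ψ r η z k ω ≤ 1 :=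
  (le_abs_self _).trans (abs_swapValue_le_one Φ τ χ Ψ r hη z k ω)

/-- Two `Z*`-values differ by at most `1` (both lie in `[0, 1]`). [folklore] -/
theorem abs_swapValue_sub_le_one (hη : 0 ≤ η) (z : Cfg N) (k : ℕ) (ω ω' : V3) :
    |swapValue σ N Φ τ χ Ψ r η z k ω - swapValue σ N Φ τ χ Ψ r η z k ω'| ≤ 1 := by
  rw [abs_sub_le_iff]
  exact ⟨by linarith [swapValue_le_one Φ τ χ Ψ r hη z k ω, swapValue_nonneg Φ τ χ Ψ r hη z k ω'],
    by linarith [swapValue_le_one Φ τ χ Ψ r hη z k ω', swapValue_nonneg Φ τ χ Ψ r hη z k ω]⟩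

/-! ## `influence ∈ [0, 1]` -/

/-- `0 ≤ influence` (unconditionally: a real `iSup` of absolute values; `0` on an empty or unbounded family).
[folklore] -/
theorem influence_nonneg (η : ℝ) (z : Cfg N) (k : ℕ) : 0 ≤ influence σ N Φ τ χ Ψ r η z k :=
  Real.iSup_nonneg fun _ => abs_nonneg _

/-- `influence ≤ 1` for `0 ≤ η`: the oscillation of a `[0, 1]`-valued function. [folklore] -/
theorem influence_le_one (hη : 0 ≤ η) (z : Cfg N) (k : ℕ) : influence σ N Φ τ χ Ψ r η z k ≤ 1 :=
  Real.iSup_le (fun p => abs_swapValue_sub_le_one Φ τ χ Ψ r hη z k p.1.1 p.1.2) zero_le_one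

/-- The family under the `iSup` defining `influence` is bounded above (by `1`), so the `iSup` is a genuine
supremum. [folklore] -/
theorem bddAbove_range_swapValue_sub (hη : 0 ≤ η) (z : Cfg N) (k : ℕ) :
    BddAbove (Set.range fun p : {p : V3 × V3 //
        IsAdmissible σ N (pairAt σ N Φ z k).1 (pairAt σ N Φ z k).2 p.1 (preAt σ N Φ z k) ∧
          IsAdmissible σ N (pairAt σ N Φ z k).1 (pairAt σ N Φ z k).2 p.2 (preAt σ N Φ z k)} =>
      |swapValue σ N Φ τ χ Ψ r η z k p.1.1 - swapValue σ N Φ τ χ Ψ r η z k p.1.2|) :=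
  ⟨1, by rintro _ ⟨p, rfl⟩; exact abs_swapValue_sub_le_one Φ τ χ Ψ r hη z k p.1.1 p.1.2⟩

/-- **The oscillation dominates every admissible difference**: for admissible kicks `ω, ω'` at the `k`-th collision,
`|swapValue_k ω − swapValue_k ω'| ≤ influence_k`. [folklore] -/
theorem abs_sub_le_influence (hη : 0 ≤ η) (z : Cfg N) (k : ℕ) {ω ω' : V3}
    (hω : IsAdmissible σ N (pairAt σ N Φ z k).1 (pairAt σ N Φ z k).2 ω (preAt σ N Φ z k))
    (hω' : IsAdmissible σ N (pairAt σ N Φ z k).1 (pairAt σ N Φ z k).2 ω' (preAt σ N Φ z k)) :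
    |swapValue σ N Φ τ χ Ψ r η z k ω - swapValue σ N Φ τ χ Ψ r η z k ω'| ≤ influence σ N Φ τ χ Ψ r η z k :=
  le_ciSup (bddAbove_range_swapValue_sub Φ τ χ Ψ r hη z k) ⟨(ω, ω'), hω, hω'⟩

/-! ## The Lindeberg-truncated influence sum -/

/-- The Lindeberg-truncated term is dominated by the full term, `influence · 1{influence > a} ≤ influence`.
[folklore] -/
theorem ite_influence_le (a η : ℝ) (z : Cfg N) (k : ℕ) :
    (if a < influence σ N Φ τ χ Ψ r η z k then influence σ N Φ τ χ Ψ r η z k else 0) ≤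
      influence σ N Φ τ χ Ψ r η z k := by
  split_ifs
  · exact le_rfl
  · exact influence_nonneg Φ τ χ Ψ r η z k

/-- The Lindeberg-truncated term is nonnegative. [folklore] -/
theorem ite_influence_nonneg (a η : ℝ) (z : Cfg N) (k : ℕ) :
    0 ≤ (if a < influence σ N Φ τ χ Ψ r η z k then influence σ N Φ τ χ Ψ r η z k else 0) := by
  split_ifs
  · exact influence_nonneg Φ τ χ Ψ r η z k
  · exact le_rfl

/-- The truncated influence sum is at most the number of collisions (each influence is `≤ 1`). [folklore] -/
theorem sum_ite_influence_le_numColl (a : ℝ) (hη : 0 ≤ η) (z : Cfg N) :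
    (∑ k ∈ Finset.range (numColl σ N Φ τ z),
        if a < influence σ N Φ τ χ Ψ r η z k then influence σ N Φ τ χ Ψ r η z k else 0) ≤
      (numColl σ N Φ τ z : ℝ) := by
  calc (∑ k ∈ Finset.range (numColl σ N Φ τ z),
        if a < influence σ N Φ τ χ Ψ r η z k then influence σ N Φ τ χ Ψ r η z k else 0)
      ≤ ∑ _k ∈ Finset.range (numColl σ N Φ τ z), (1 : ℝ) :=
        Finset.sum_le_sum fun k _ => (ite_influence_le Φ τ χ Ψ r a η z k).trans (influence_le_one Φ τ χ Ψ r hη z k)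
    _ = (numColl σ N Φ τ z : ℝ) := by simp

/-- The truncated influence sum is antitone in the threshold. [folklore] -/
theorem sum_ite_influence_antitone {a b : ℝ} (hab : a ≤ b) (η : ℝ) (z : Cfg N) :
    (∑ k ∈ Finset.range (numColl σ N Φ τ z),
        if b < influence σ N Φ τ χ Ψ r η z k then influence σ N Φ τ χ Ψ r η z k else 0) ≤
      ∑ k ∈ Finset.range (numColl σ N Φ τ z),
        if a < influence σ N Φ τ χ Ψ r η z k then influence σ N Φ τ χ Ψ r η z k else 0 := by
  refine Finset.sum_le_sum fun k _ => ?_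
  by_cases hb : b < influence σ N Φ τ χ Ψ r η z k
  · rw [if_pos hb, if_pos (hab.trans_lt hb)]
  · rw [if_neg hb]
    exact ite_influence_nonneg Φ τ χ Ψ r a η z k

/-! ## The swap integrand is dominated by the influence (the form S3b consumes) -/

/-- **The swap integrand is dominated by the one-kick influence** whenever the restricted reference mean is a genuine
average: if the admissible set `A` of the `k`-th collision has positive finite flux measure and `ω ↦ swapValue_k ω`
is integrable on it, then for every admissible `ω₀`, `|swapValue_k ω₀ − restrictedMean_k swapValue_k| ≤ influence_k`
(average of `|swapValue ω₀ − swapValue ω| ≤ influence` over `ω ∈ A`; `norm_setIntegral_le_of_norm_le_const`). This is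
the form in which S3b consumes S2: off the exceptional collisions `|D_k| ≤ C ε/(N+1)`. [folklore] -/
theorem abs_swapValue_sub_restrictedMean_le_influence (hη : 0 ≤ η) (z : Cfg N) (k : ℕ) {ω₀ : V3}
    (hω₀ : IsAdmissible σ N (pairAt σ N Φ z k).1 (pairAt σ N Φ z k).2 ω₀ (preAt σ N Φ z k))
    (hA0 : fluxLaw ((preAt σ N Φ z k) (pairAt σ N Φ z k).1).2 ((preAt σ N Φ z k) (pairAt σ N Φ z k).2).2
        {ω : Metric.sphere (0 : V3) 1 |
          IsAdmissible σ N (pairAt σ N Φ z k).1 (pairAt σ N Φ z k).2 (ω : V3) (preAt σ N Φ z k)} ≠ 0)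
    (hAtop : fluxLaw ((preAt σ N Φ z k) (pairAt σ N Φ z k).1).2 ((preAt σ N Φ z k) (pairAt σ N Φ z k).2).2
        {ω : Metric.sphere (0 : V3) 1 |
          IsAdmissible σ N (pairAt σ N Φ z k).1 (pairAt σ N Φ z k).2 (ω : V3) (preAt σ N Φ z k)} ≠ ∞)
    (hF : IntegrableOn (fun ω : Metric.sphere (0 : V3) 1 => swapValue σ N Φ τ χ Ψ r η z k (ω : V3))
        {ω : Metric.sphere (0 : V3) 1 |
          IsAdmissible σ N (pairAt σ N Φ z k).1 (pairAt σ N Φ z k).2 (ω : V3) (preAt σ N Φ z k)}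
        (fluxLaw ((preAt σ N Φ z k) (pairAt σ N Φ z k).1).2 ((preAt σ N Φ z k) (pairAt σ N Φ z k).2).2)) :
    |swapValue σ N Φ τ χ Ψ r η z k ω₀ - restrictedMean σ N Φ z k (swapValue σ N Φ τ χ Ψ r η z k)| ≤
      influence σ N Φ τ χ Ψ r η z k := by
  set y := preAt σ N Φ z k with hy
  set p := pairAt σ N Φ z k with hp
  set A : Set (Metric.sphere (0 : V3) 1) := {ω | IsAdmissible σ N p.1 p.2 (ω : V3) y} with hA
  set μ := fluxLaw (y p.1).2 (y p.2).2 with hμ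
  set F : V3 → ℝ := swapValue σ N Φ τ χ Ψ r η z k with hFdef
  set I : ℝ := influence σ N Φ τ χ Ψ r η z k with hI
  have hm : (μ A).toReal ≠ 0 := ENNReal.toReal_ne_zero.2 ⟨hA0, hAtop⟩
  have hrM : restrictedMean σ N Φ z k F = (μ A).toReal⁻¹ * ∫ ω in A, F (ω : V3) ∂μ := rfl
  have hconst : ∫ _ in A, F ω₀ ∂μ = (μ A).toReal * F ω₀ := by
    rw [setIntegral_const, smul_eq_mul, measureReal_def]
  have hsub : ∫ ω in A, (F ω₀ - F (ω : V3)) ∂μ = ∫ _ in A, F ω₀ ∂μ - ∫ ω in A, F (ω : V3) ∂μ :=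
    integral_sub (integrableOn_const hAtop) hF
  have key : F ω₀ - restrictedMean σ N Φ z k F = (μ A).toReal⁻¹ * ∫ ω in A, (F ω₀ - F (ω : V3)) ∂μ := by
    rw [hrM, hsub, hconst, mul_sub, ← mul_assoc, inv_mul_cancel₀ hm, one_mul]
  have hbound : ‖∫ ω in A, (F ω₀ - F (ω : V3)) ∂μ‖ ≤ I * μ.real A :=
    norm_setIntegral_le_of_norm_le_const hAtop.lt_top fun ω hω => by
      rw [Real.norm_eq_abs]
      exact abs_sub_le_influence Φ τ χ Ψ r hη z k hω₀ hω
  rw [key, abs_mul, abs_inv, abs_of_nonneg ENNReal.toReal_nonneg]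
  rw [Real.norm_eq_abs, measureReal_def] at hbound
  calc (μ A).toReal⁻¹ * |∫ ω in A, (F ω₀ - F (ω : V3)) ∂μ| ≤ (μ A).toReal⁻¹ * (I * (μ A).toReal) :=
        mul_le_mul_of_nonneg_left hbound (inv_nonneg.2 ENNReal.toReal_nonneg)
    _ = I := by field_simp

/-- **`|swapIntegrand_k ω| ≤ influence_k` for every kick `ω`** (zero off the admissible set), whenever the restricted
reference mean is a genuine average (same hypotheses). [folklore] -/
theorem abs_swapIntegrand_le_influence (hη : 0 ≤ η) (z : Cfg N) (k : ℕ)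
    (hA0 : fluxLaw ((preAt σ N Φ z k) (pairAt σ N Φ z k).1).2 ((preAt σ N Φ z k) (pairAt σ N Φ z k).2).2
        {ω : Metric.sphere (0 : V3) 1 |
          IsAdmissible σ N (pairAt σ N Φ z k).1 (pairAt σ N Φ z k).2 (ω : V3) (preAt σ N Φ z k)} ≠ 0)
    (hAtop : fluxLaw ((preAt σ N Φ z k) (pairAt σ N Φ z k).1).2 ((preAt σ N Φ z k) (pairAt σ N Φ z k).2).2
        {ω : Metric.sphere (0 : V3) 1 |
          IsAdmissible σ N (pairAt σ N Φ z k).1 (pairAt σ N Φ z k).2 (ω : V3) (preAt σ N Φ z k)} ≠ ∞)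
    (hF : IntegrableOn (fun ω : Metric.sphere (0 : V3) 1 => swapValue σ N Φ τ χ Ψ r η z k (ω : V3))
        {ω : Metric.sphere (0 : V3) 1 |
          IsAdmissible σ N (pairAt σ N Φ z k).1 (pairAt σ N Φ z k).2 (ω : V3) (preAt σ N Φ z k)}
        (fluxLaw ((preAt σ N Φ z k) (pairAt σ N Φ z k).1).2 ((preAt σ N Φ z k) (pairAt σ N Φ z k).2).2))
    (ω : V3) :
    |swapIntegrand σ N Φ τ χ Ψ r η z k ω| ≤ influence σ N Φ τ χ Ψ r η z k := by
  by_cases hω : IsAdmissible σ N (pairAt σ N Φ z k).1 (pairAt σ N Φ z k).2 ω (preAt σ N Φ z k)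
  · unfold swapIntegrand
    rw [if_pos hω]
    exact abs_swapValue_sub_restrictedMean_le_influence Φ τ χ Ψ r hη z k hω hA0 hAtop hF
  · rw [swapIntegrand_of_not_admissible hω, abs_zero]
    exact influence_nonneg Φ τ χ Ψ r η z k

end KickMatchedHardSphereGas

end Literature.MathematicalPhysics.KineticTheory

end
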